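import Summits.QuantumFields.YangMills.Theorems.BalabanUVNodesN22EdgeAtW1Reading12
import Summits.QuantumFields.YangMills.Theorems.BalabanUVNodesN22W1StripN18EdgeOfRecord

/-!
# THE EDGE N18 → N22 AT THE RATE READING OF RECORD WHOSE W1 COMPONENT IS `Node00.W1.ReadingData.ofRecord` — AT THE REGIME ∕ TUPLE HOME (strip currency) AND IN
# THE ANALYTIC SUP-LETTER CURRENCY (canonical and regime homes): module 7's three edges with dag-n22-c's pairing coherence (C1)(C2) DISCHARGED BY NAME
# (`YMDAG.N22.W1.pairingCoherence_ofRecord`, their module 10 p477488), so that only node N18's stub, the junk-freeness pin (J) on the residual towers `S`, the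
# inputs' numerals and STRIP ∕ (A) remain — NO identification clause, NO transport hypothesis (ANY transport table `T₀`)

Track A of `YM-PLAN.md` (cell `pub-ymgap`, HUMAN RULING D-0062), R134 seat `pub-ymgap-dag-n22-e` ((T-RATE) pen ∕ N22 NE9 s2), gen 3, module 7b.  THEOREMS ONLY (no `def`, no
`sorry`); `--supports` K3″ `SpineGivenEndpointR12` (stmt-QuantumFields-19908) as a helper; restate-immune (no Theses import).  The reading is dag-n18-d g2's ∕
dag-n22-c g3's ∕ node00-def-W1 g3's common instance `readingOfRecord₁₂ (fun F θ ↦ ReadingData.ofRecord F θ.τ9.M N (S F θ) (gauge F θ) (hg F θ) (T₀ F θ) (li F θ)) ℓ₃ ne2 ne1`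
(module 6, p469629), at which dag-n18-d's module 10 (`…N18AtReadingOfRecord12`, p474555) states `S_N18` and dag-n22-c's module 10 the canonical-home strip edge.

WHAT THIS MODULE PROVES ([folklore] bookkeeping; one `exact`∕`refine` each over module 7 + `pairingCoherence_ofRecord`).
* `s_N22_readingOfRecord₁₂On_ofRecord_of_s_N18_stripBound` — REGIME ∕ TUPLE HOME `RRec₁₂On 𝔯 Rg` (any `Rg`), strip currency: `S_N18 (RRec₁₂On 𝔯 Rg)` + (per admissible
  tuple with provisos IN `Rg`) (J), the numerals, STRIP per run length ⟹ `S_N22 (RRec₁₂On 𝔯 Rg)`.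
* `s_N22_readingOfRecord₁₂_ofRecord_of_s_N18_analytic` — canonical home, analytic sup-letter currency (A) (module 4's ROAD-3 `hA` literal at the reading of record).
* `s_N22_readingOfRecord₁₂On_ofRecord_of_s_N18_analytic` — regime home, analytic currency.
* `edgeNumerals_nonvacuous` — the twelve numerals are jointly satisfiable (explicit letters; A5).

HONEST FRAMING.  COUNT-NEUTRAL kernel bookkeeping BY NAME; NE5 ∕ NE9 NOT PRINTED for d = 4 and NOT PROVED; `S_N18`, (J), STRIP ∕ (A), the numerals are DISPLAYED hypotheses;
the towers `S F θ k` are residual DATA (termless towers satisfy everything — INHABITATION IS NOT CONTENT); nothing of Bałaban's is asserted; no inhabitant of any Stage-12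
key claimed (K0″ open); N22 NOT discharged; counts UNMOVED (typed 28∕28 · discharged 5∕27, A 5∕28); one finite four-torus programme at fixed `ε` — NOT ℝ⁴, NOT infinite
volume, NOT OS, NOT a mass gap, NOT Clay.  No decl carries a cite tag.
-/

noncomputable section

namespace YMDAG.N22

open Set Metric
open scoped BigOperators
open Literature.MathematicalPhysics.QuantumFieldTheory.Balaban1983to89
open Literature.MathematicalPhysics.QuantumFieldTheory.Balaban1983to89.T4Continuum
open Literature.MathematicalPhysics.QuantumFieldTheory.Balaban1983to89.T4OutputRate
open Literature.MathematicalPhysics.QuantumFieldTheory.Balaban1983to89.TreeLengthTorus (torusTreeLen)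
open Literature.MathematicalPhysics.QuantumFieldTheory.Balaban1983to89.Node00
  (Stage12Params NE2Objects₁₁ NE3Letters₁₁ MatA ιSU)
open Literature.MathematicalPhysics.QuantumFieldTheory.Balaban1983to89.Node00.Sect2 (domSys CPair ofBackgroundC)
open Literature.MathematicalPhysics.QuantumFieldTheory.Balaban1983to89.Node00.W1 (ReadingData LetterInputs ClusterTower functionalC termC)
open YMDAG.UVSplit
open YMDAG.N22.W1 (pairingCoherence_ofRecord)

variable {N : ℕ} [NeZero N]
  (S : (F : T4Family) → (θ : Stage12Params F N) → (k : ℕ) → ClusterTower (F.P k) (MatA N) θ.τ9.M)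
  (gauge : (F : T4Family) → (θ : Stage12Params F N) → (k : ℕ) → GaugeField (F.P k) 0 (Node00.SU N) → GaugeField (F.P k) 0 (Node00.SU N) → ℝ)
  (hg : ∀ (F : T4Family) (θ : Stage12Params F N) (k : ℕ) (U U' : GaugeField (F.P k) 0 (Node00.SU N)), 0 ≤ gauge F θ k U U')
  (T₀ : (F : T4Family) → (θ : Stage12Params F N) → (k : ℕ) → GaugeField (F.P (k + 1)) 0 (Node00.SU N) → GaugeField (F.P k) 0 (Node00.SU N))
  (li : (F : T4Family) → Stage12Params F N → LetterInputs) (ℓ₃ : T4Family → NE3Letters₁₁)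
  (ne2 : (F : T4Family) → Stage12Params F N → (ℕ → ℝ) → List (ULoop F) → ℕ → NE2Objects₁₁)
  (ne1 : (F : T4Family) → Stage12Params F N → (ℕ → ℝ) → List (ULoop F) → NE1pCarriers)

open Classical in
/-- **THE EDGE N18 → N22 AT THE READING OF RECORD (W1 component `ReadingData.ofRecord`), REGIME ∕ TUPLE HOME, STRIP CURRENCY.**  For ANY regime `Rg`:
`S_N18 (RRec₁₂On 𝔯 Rg)` + per admissible Stage-12 tuple with provisos IN `Rg`: the pin (J) for the towers `S F θ`, the letter inputs' numerals (dag-n22-c's twelve), and per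
run length a space table with the readings `(ιU, 0)` inside and STRIP-(1.18) for `S F θ k` ⟹ `S_N22 (RRec₁₂On 𝔯 Rg)` — module 7 §1 with `hcoh` := `pairingCoherence_ofRecord`
+ (J).  (`𝔯 := readingOfRecord₁₂ (fun F θ ↦ ReadingData.ofRecord …) ℓ₃ ne2 ne1`; `ℓ₃ ∕ ne2 ∕ ne1`, the gauge and `T₀` are not read by N22.) [folklore] -/
theorem s_N22_readingOfRecord₁₂On_ofRecord_of_s_N18_stripBound (Rg : (F : T4Family) → Stage12Params F N → Prop)
    (h18 : S_N18 (RRec₁₂On (readingOfRecord₁₂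
      (fun F θ => ReadingData.ofRecord F θ.τ9.M N (S F θ) (gauge F θ) (hg F θ) (T₀ F θ) (li F θ)) ℓ₃ ne2 ne1) Rg))
    (hjunk : ∀ (F : T4Family) (θ : Stage12Params F N), θ.Provisos₁₂ F N → Rg F θ → θ.Admissible F N →
      ∀ (k : ℕ) (X : Node00.W1.Dom (F.P k) θ.τ9.M), k < X.1 → ∀ (g : ℕ → ℝ) (φ : CPair (F.P k) (MatA N)), functionalC (S F θ k) g φ X = 0)
    (hnum : ∀ (F : T4Family) (θ : Stage12Params F N), θ.Provisos₁₂ F N → Rg F θ → θ.Admissible F N →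
      0 < (li F θ).C₀ ∧ 0 < (li F θ).θ₅ ∧ (li F θ).θ₅ < 1 ∧ 0 ≤ (li F θ).C₅ ∧ 2 * (li F θ).C₅ / (1 - (li F θ).θ₅) ≤ (li F θ).C₀ ∧ 0 < (li F θ).A ∧
        (li F θ).θ₅ ≤ (li F θ).μ ∧ (li F θ).C₀ ≤ 2 * (li F θ).A ∧ 0 < (li F θ).r ∧ 0 < (li F θ).s ∧ (li F θ).s < 1 ∧ 1 ≤ (li F θ).μ)
    (hstrip : ∀ (F : T4Family) (θ : Stage12Params F N), θ.Provisos₁₂ F N → Rg F θ → θ.Admissible F N → ∀ (k : ℕ),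
      ∃ sp : (j : ℕ) → (domSys (F.P k) θ.τ9.M j).Dom → Set (CPair (F.P k) (MatA N)),
        (∀ (j : ℕ) (U : GaugeField (F.P k) 0 (Node00.SU N)) (Y : (domSys (F.P k) θ.τ9.M j).Dom), ofBackgroundC (ιSU N) U ∈ sp j Y) ∧
        (∀ (j : ℕ) (g : ℕ → ℝ), g ∈ Window θ.γ → ∀ (i : ℕ) (Y : (domSys (F.P k) θ.τ9.M j).Dom) (ψ : CPair (F.P k) (MatA N)), ψ ∈ sp j Y →
          ∃ (Ec : ℂ → ℂ) (O : Set ℂ), IsOpen O ∧ (∀ t ∈ Ioc (0 : ℝ) θ.γ, closedBall (t : ℂ) (li F θ).r ⊆ O) ∧ DifferentiableOn ℂ Ec O ∧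
            (∀ z ∈ O, ‖Ec z‖ ≤ (li F θ).A * Real.exp (-((li F θ).κ * torusTreeLen Y.1))) ∧
            (∀ t ∈ Ioc (0 : ℝ) θ.γ, Ec t = termC (S F θ k) j Y (Function.update g i t) ψ))) :
    S_N22 (RRec₁₂On (readingOfRecord₁₂
      (fun F θ => ReadingData.ofRecord F θ.τ9.M N (S F θ) (gauge F θ) (hg F θ) (T₀ F θ) (li F θ)) ℓ₃ ne2 ne1) Rg) := by
  refine s_N22_rRec₁₂On_w1Assignment_of_s_N18_stripBound _ ne1 Rg h18 (fun F θ hP hRg hθ => ?_) hnum hstrip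
  obtain ⟨hfst, hdj, hsurj, hbg⟩ := pairingCoherence_ofRecord (N := N) (S F θ) (gauge F θ) (hg F θ) (T₀ F θ) (li F θ)
  refine ⟨hfst, hdj, hsurj, hbg, fun k g U X hk => ?_⟩
  show (functionalC (S F θ k) g (ofBackgroundC (ιSU N) U) X).re = 0
  rw [hjunk F θ hP hRg hθ k X hk]
  simp

/-- **THE EDGE AT THE READING OF RECORD (W1 component `ReadingData.ofRecord`), CANONICAL HOME, ANALYTIC SUP-LETTER CURRENCY** — module 7's
`s_N22_readingOfRecord₁₂_of_s_N18_analytic` with `hcoh` := `pairingCoherence_ofRecord` + (J): `S_N18 (RRec₁₂ 𝔯)` + per admissible tuple with provisos: (J), the eleven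
numerals, and per run length the analytic letter (A) for `Re E^{(j)}_{S F θ k}(X; ·; (ιU, 0))` (module 4's `hA` literal: closed `li.r`-discs, sup letter
`li.A·li.μ^{j−1−i}·e^{−κ d_j(X)}`) ⟹ `S_N22 (RRec₁₂ 𝔯)`. [folklore] -/
theorem s_N22_readingOfRecord₁₂_ofRecord_of_s_N18_analytic
    (h18 : S_N18 (RRec₁₂ (readingOfRecord₁₂
      (fun F θ => ReadingData.ofRecord F θ.τ9.M N (S F θ) (gauge F θ) (hg F θ) (T₀ F θ) (li F θ)) ℓ₃ ne2 ne1)))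
    (hjunk : ∀ (F : T4Family) (θ : Stage12Params F N), θ.Provisos₁₂ F N → θ.Admissible F N →
      ∀ (k : ℕ) (X : Node00.W1.Dom (F.P k) θ.τ9.M), k < X.1 → ∀ (g : ℕ → ℝ) (φ : CPair (F.P k) (MatA N)), functionalC (S F θ k) g φ X = 0)
    (hA : ∀ (F : T4Family) (θ : Stage12Params F N), θ.Provisos₁₂ F N → θ.Admissible F N → ∀ (k : ℕ),
      ∀ g ∈ Window θ.γ, ∀ (U : GaugeField (F.P k) 0 (Node00.SU N)) (X : Node00.W1.Dom (F.P k) θ.τ9.M) (i : ℕ), i < X.1 →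
        ∃ (Fz : ℂ → ℂ) (Dset : Set ℂ), DifferentiableOn ℂ Fz Dset ∧
          (∀ z ∈ Dset, ‖Fz z‖ ≤ (li F θ).A * (li F θ).μ ^ (X.1 - 1 - i) * Real.exp (-((li F θ).κ * (domSys (F.P k) θ.τ9.M X.1).dj X.2))) ∧
          (∀ t ∈ Ioc (0 : ℝ) θ.γ, closedBall (t : ℂ) (li F θ).r ⊆ Dset) ∧
          (∀ t ∈ Ioc (0 : ℝ) θ.γ, Fz t = ((functionalC (S F θ k) (Function.update g i t) (ofBackgroundC (ιSU N) U) X).re : ℂ)))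
    (hnum : ∀ (F : T4Family) (θ : Stage12Params F N), θ.Provisos₁₂ F N → θ.Admissible F N →
      0 < (li F θ).C₀ ∧ 0 < (li F θ).θ₅ ∧ (li F θ).θ₅ < 1 ∧ 0 ≤ (li F θ).C₅ ∧ 2 * (li F θ).C₅ / (1 - (li F θ).θ₅) ≤ (li F θ).C₀ ∧ 0 < (li F θ).A ∧
        (li F θ).θ₅ ≤ (li F θ).μ ∧ (li F θ).C₀ ≤ 2 * (li F θ).A ∧ 0 < (li F θ).r ∧ 0 < (li F θ).s ∧ (li F θ).s < 1) :
    S_N22 (RRec₁₂ (readingOfRecord₁₂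
      (fun F θ => ReadingData.ofRecord F θ.τ9.M N (S F θ) (gauge F θ) (hg F θ) (T₀ F θ) (li F θ)) ℓ₃ ne2 ne1)) := by
  refine s_N22_readingOfRecord₁₂_of_s_N18_analytic ne1 _ ℓ₃ ne2 h18 (fun F θ hP hθ => ?_) (fun F θ hP hθ k g hg' U X i hi => hA F θ hP hθ k g hg' U X i hi) hnum
  obtain ⟨hfst, hdj, hsurj, hbg⟩ := pairingCoherence_ofRecord (N := N) (S F θ) (gauge F θ) (hg F θ) (T₀ F θ) (li F θ)
  refine ⟨hfst, hdj, hsurj, hbg, fun k g U X hk => ?_⟩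
  show (functionalC (S F θ k) g (ofBackgroundC (ιSU N) U) X).re = 0
  rw [hjunk F θ hP hθ k X hk]
  simp

/-- **THE SAME AT THE REGIME ∕ TUPLE HOME** `RRec₁₂On 𝔯 Rg` (any `Rg`), analytic currency — module 7's `s_N22_rRec₁₂On_w1_of_s_N18_analytic` at `𝔇 := pinnedInputs₁₂ w1 ℓ₃ ne2`. [folklore] -/
theorem s_N22_readingOfRecord₁₂On_ofRecord_of_s_N18_analytic (Rg : (F : T4Family) → Stage12Params F N → Prop)
    (h18 : S_N18 (RRec₁₂On (readingOfRecord₁₂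
      (fun F θ => ReadingData.ofRecord F θ.τ9.M N (S F θ) (gauge F θ) (hg F θ) (T₀ F θ) (li F θ)) ℓ₃ ne2 ne1) Rg))
    (hjunk : ∀ (F : T4Family) (θ : Stage12Params F N), θ.Provisos₁₂ F N → Rg F θ → θ.Admissible F N →
      ∀ (k : ℕ) (X : Node00.W1.Dom (F.P k) θ.τ9.M), k < X.1 → ∀ (g : ℕ → ℝ) (φ : CPair (F.P k) (MatA N)), functionalC (S F θ k) g φ X = 0)
    (hA : ∀ (F : T4Family) (θ : Stage12Params F N), θ.Provisos₁₂ F N → Rg F θ → θ.Admissible F N → ∀ (k : ℕ),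
      ∀ g ∈ Window θ.γ, ∀ (U : GaugeField (F.P k) 0 (Node00.SU N)) (X : Node00.W1.Dom (F.P k) θ.τ9.M) (i : ℕ), i < X.1 →
        ∃ (Fz : ℂ → ℂ) (Dset : Set ℂ), DifferentiableOn ℂ Fz Dset ∧
          (∀ z ∈ Dset, ‖Fz z‖ ≤ (li F θ).A * (li F θ).μ ^ (X.1 - 1 - i) * Real.exp (-((li F θ).κ * (domSys (F.P k) θ.τ9.M X.1).dj X.2))) ∧
          (∀ t ∈ Ioc (0 : ℝ) θ.γ, closedBall (t : ℂ) (li F θ).r ⊆ Dset) ∧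
          (∀ t ∈ Ioc (0 : ℝ) θ.γ, Fz t = ((functionalC (S F θ k) (Function.update g i t) (ofBackgroundC (ιSU N) U) X).re : ℂ)))
    (hnum : ∀ (F : T4Family) (θ : Stage12Params F N), θ.Provisos₁₂ F N → Rg F θ → θ.Admissible F N →
      0 < (li F θ).C₀ ∧ 0 < (li F θ).θ₅ ∧ (li F θ).θ₅ < 1 ∧ 0 ≤ (li F θ).C₅ ∧ 2 * (li F θ).C₅ / (1 - (li F θ).θ₅) ≤ (li F θ).C₀ ∧ 0 < (li F θ).A ∧
        (li F θ).θ₅ ≤ (li F θ).μ ∧ (li F θ).C₀ ≤ 2 * (li F θ).A ∧ 0 < (li F θ).r ∧ 0 < (li F θ).s ∧ (li F θ).s < 1) :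
    S_N22 (RRec₁₂On (readingOfRecord₁₂
      (fun F θ => ReadingData.ofRecord F θ.τ9.M N (S F θ) (gauge F θ) (hg F θ) (T₀ F θ) (li F θ)) ℓ₃ ne2 ne1) Rg) := by
  refine s_N22_rRec₁₂On_w1_of_s_N18_analytic _ ne1 Rg h18 (fun F θ hP hRg hθ => ?_)
    (fun F θ hP hRg hθ k g hg' U X i hi => hA F θ hP hRg hθ k g hg' U X i hi) hnum
  obtain ⟨hfst, hdj, hsurj, hbg⟩ := pairingCoherence_ofRecord (N := N) (S F θ) (gauge F θ) (hg F θ) (T₀ F θ) (li F θ)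
  refine ⟨hfst, hdj, hsurj, hbg, fun k g U X hk => ?_⟩
  show (functionalC (S F θ k) g (ofBackgroundC (ιSU N) U) X).re = 0
  rw [hjunk F θ hP hRg hθ k X hk]
  simp

omit [NeZero N] in
/-- **NON-VACUITY OF THE EDGE's NUMERALS** (referee standard A5): the twelve letter-input inequalities the strip-currency edge asks (`0 < C₀`, `0 < θ₅ < 1`, `0 ≤ C₅`,
`2C₅∕(1−θ₅) ≤ C₀`, `0 < A`, `θ₅ ≤ μ`, `C₀ ≤ 2A`, `0 < r`, `0 < s < 1`, `1 ≤ μ`; the analytic currency asks the first eleven) are JOINTLY satisfiable — witness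
`κ = 0, θ₅ = 1∕2, C₅ = 1, cr = 0, ρ = 1, C₀ = 4, A = 2, μ = 1, r = 1, s = 1∕2`.  Letters only; says nothing about any tower. [folklore] -/
theorem edgeNumerals_nonvacuous : ∃ li : LetterInputs,
    0 < li.C₀ ∧ 0 < li.θ₅ ∧ li.θ₅ < 1 ∧ 0 ≤ li.C₅ ∧ 2 * li.C₅ / (1 - li.θ₅) ≤ li.C₀ ∧ 0 < li.A ∧ li.θ₅ ≤ li.μ ∧ li.C₀ ≤ 2 * li.A ∧ 0 < li.r ∧
      0 < li.s ∧ li.s < 1 ∧ 1 ≤ li.μ :=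
  ⟨⟨0, 1 / 2, 1, 0, 1, 4, 2, 1, 1, 1 / 2⟩, by norm_num⟩

end YMDAG.N22

end
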